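import Literature.Combinatorics.SimpleGraph.HamiltonianGadgetTransport
import HarnessLib

/-!
# Hamiltonian-path counts are invariant under relabelling

For an embedding `φ : α ↪ β`, the Hamiltonian `s`–`t` paths of `G.map φ` through `V.map φ` are
exactly the images of the Hamiltonian `s`–`t` paths of `G` through `V` (`hamSetRF_map`), so the
constrained counts agree (`hamCountRF_map`, `hamCount_map`). Used to renumber the graph of a
formula (`FormulaGraphCount.lean`) on `0, …, M-1` before drawing it in the grid.

## References

* M. R. Garey, D. S. Johnson, *Computers and Intractability*, Freeman 1979, §3.2.2.
-/

namespace Literature.Combinatorics.SimpleGraph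

variable {α β : Type*} [DecidableEq α] [DecidableEq β] (φ : α ↪ β)

/-- A Hamiltonian path of the relabelled graph is the image of a Hamiltonian path. [folklore] -/
theorem IsHamPathOn.exists_eq_map {G : _root_.SimpleGraph α} {V : Finset α} {s t : α} {l' : List β}
    (h : IsHamPathOn (G.map φ) (V.map φ) (φ s) (φ t) l') : ∃ l, l' = l.map φ ∧ IsHamPathOn G V s t l := by
  obtain ⟨hnd, hV, hs, ht, hc⟩ := h
  obtain ⟨l, rfl⟩ := exists_eq_map_of_forall_mem_range φ (ys := l') fun y hy => by
    have : y ∈ V.map φ := by rw [← hV]; exact List.mem_toFinset.2 hy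
    obtain ⟨x, -, rfl⟩ := Finset.mem_map.1 this
    exact ⟨x, rfl⟩
  refine ⟨l, rfl, (List.nodup_map_iff φ.injective).1 hnd, ?_, ?_, ?_, (isChain_map_iff φ).1 hc⟩
  · ext x
    have := congrArg (fun S : Finset β => φ x ∈ S) hV
    simp only [List.mem_toFinset, List.mem_map, Finset.mem_map', eq_iff_iff] at this
    rw [List.mem_toFinset, ← this]
    constructor
    · exact fun hx => ⟨x, hx, rfl⟩
    · rintro ⟨y, hy, hxy⟩
      rwa [← φ.injective hxy]
  · cases l with
    | nil => simp at hs
    | cons a r =>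
      simp only [List.map_cons, List.head?_cons, Option.some.injEq] at hs
      simp [φ.injective hs]
  · rw [List.getLast?_map] at ht
    cases hl : l.getLast? with
    | none => rw [hl] at ht; simp at ht
    | some a =>
      rw [hl] at ht
      simp only [Option.map_some, Option.some.injEq] at ht
      rw [φ.injective ht]

/-- **The constrained Hamiltonian paths of the relabelled graph are the images of those of the
graph.** [folklore] -/
theorem hamSetRF_map (G : _root_.SimpleGraph α) (V : Finset α) (s t : α) (R F : Finset (α × α)) :
    hamSetRF (G.map φ) (V.map φ) (φ s) (φ t) (R.map (φ.prodMap φ)) (F.map (φ.prodMap φ)) =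
      List.map φ '' hamSetRF G V s t R F := by
  ext l'
  simp only [hamSetRF, Set.mem_setOf_eq, Set.mem_image]
  constructor
  · rintro ⟨hl', hR, hF⟩
    obtain ⟨l, rfl, hl⟩ := hl'.exists_eq_map φ
    refine ⟨l, ⟨hl, fun e he => ?_, fun e he hu => ?_⟩, rfl⟩
    · have := hR (φ e.1, φ e.2) ((mem_map_prodMap_iff φ).2 (by simpa using he))
      exact (uses_map_iff φ.injective).1 this
    · exact hF (φ e.1, φ e.2) ((mem_map_prodMap_iff φ).2 (by simpa using he)) ((uses_map_iff φ.injective).2 hu)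
  · rintro ⟨l, ⟨hl, hR, hF⟩, rfl⟩
    have hmap : IsHamPathOn (G.map φ) (V.map φ) (φ s) (φ t) (l.map φ) := by
      have := hl.map φ.injective (G' := G.map φ) (fun a b hab => (map_adj_iff φ).2 hab)
      rwa [Finset.map_eq_image]
    refine ⟨hmap, fun e' he' => ?_, fun e' he' hu => ?_⟩
    · obtain ⟨e, he, rfl⟩ := exists_eq_of_mem_map_prodMap φ he'
      exact (uses_map_iff φ.injective).2 (hR e he)
    · obtain ⟨e, he, rfl⟩ := exists_eq_of_mem_map_prodMap φ he'
      exact hF e he ((uses_map_iff φ.injective).1 hu)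

/-- **Constrained Hamiltonian-path counts are invariant under relabelling.** [folklore] -/
theorem hamCountRF_map (G : _root_.SimpleGraph α) (V : Finset α) (s t : α) (R F : Finset (α × α)) :
    hamCountRF (G.map φ) (V.map φ) (φ s) (φ t) (R.map (φ.prodMap φ)) (F.map (φ.prodMap φ)) = hamCountRF G V s t R F := by
  rw [hamCountRF, hamCountRF, hamSetRF_map, Set.ncard_image_of_injective _ ((List.map_injective_iff).2 φ.injective)]

/-- **Hamiltonian-path counts are invariant under relabelling.** [folklore] -/
theorem hamCount_map (G : _root_.SimpleGraph α) (V : Finset α) (s t : α) :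
    hamCount (G.map φ) (V.map φ) (φ s) (φ t) = hamCount G V s t := by
  rw [hamCount, hamCount, ← hamCountRF_map φ G V s t ∅ ∅, Finset.map_empty]

end Literature.Combinatorics.SimpleGraph
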